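import Summits.BirchSwinnertonDyer.BirchSwinnertonDyer.Theorems.PrintX6KobayashiUpperHalf
import Summits.BirchSwinnertonDyer.Rank1Residual.Supersingular.GoodSSTowerOfSurj
import Summits.BirchSwinnertonDyer.Rank1Residual.Supersingular.KobayashiMainConjectureX7
import Literature.NumberTheory.EllipticCurves.Rank1Residual.Typed.X7
import Summits.BirchSwinnertonDyer.BirchSwinnertonDyer.Theorems.PrintX6UnitValue
import HarnessLib

/-!
# Good supersingular `p` with `a_p = 0` and `ρ̄_{E,p}` onto, ANY conductor: the rank-zero UPPER half
# `ord_p #Ш ≤ ord_p #Ш_an` in the kernel (Kobayashi 2003 Thm. 4.1 + B. D. Kim 2013 Cor. 3.15) —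
# class X7 ∩ {surj} (rung K3 corner A7, `r_an = 0`) re-based off Wuthrich Prop. 21 / Perrin-Riou Prop. 4.8

HONEST FRAMING (cell `bsd-print-x6`, prover p2; a by-product of the leaf-A6 file
`Theorems/PrintX6KobayashiUpperHalf.lean`, p532875, whose main theorem
`missingUpperBoundAt_of_thm41_of_towerSurj` is CLASS-FREE: odd good `p`, `a_p = 0`, `E[p]`
irreducible, `ρ̄_{E,p^m}` onto for all `m`, `L(E,1) ≠ 0`). THEOREMS ONLY; nothing about any curve is
asserted; BSD is not proved by any of this; per-pair consumers of corner A7 (`ClassX7 = GoodSS ∧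
¬ Semistable`) are served, no class is closed (X7 ∩ {r_an = 0} still needs its Eisenstein half:
route `SignedLowerHalves` item 3 `KobayashiLowerHalfLargeImage`, stmt-BirchSwinnertonDyer-19001).

What is recorded. At a good supersingular odd `p` with `a_p = 0` and `ρ̄_{E,p}` SURJECTIVE (the
census bit `surj(p)`; NO semistability), the `p`-adic tower is onto (`GoodSS.towerSurj_of_surj`:
Serre IV-23 at `p ≥ 5`, Wuthrich 2014 Lemma 20 at `p = 3`, both PROVED in the tree) and `E[p]` is
irreducible (Serre Prop. 12, `hasIrreducibleModPGaloisRep_of_dvd_frobeniusTrace`), so the kernel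
chain applies:
* `GoodSS.missingUpperBoundAt_rankZero_of_thm41_of_surj` — `MissingUpperBoundAt W p` from the eight
  refereed inputs (Kobayashi Thm. 4.1 / 1.2, Kim Cor. 3.15, period units, modularity ×2, GZK);
* `X7.missingUpperBoundAt_rankZero_of_thm41_of_surj` (class reading; `a_p = 0` displayed — automatic
  at `p ≥ 5`, `ClassX7.frobeniusTrace_eq_zero_of_five_le`), `X7.bsdp_of_missingLowerBoundAt_of_thm41_of_surj`
  (the twin of `Typed.X7.bsdp_of_missingLowerBoundAt_of_surj` with Wuthrich Prop. 21 replaced), and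
  the UNIT-VALUE cells of A7 ∩ {surj, a_p = 0}: `X7.bsdp_rankZero_of_shaAn_le_of_thm41_of_surj`.
Beyond-print theorem: NO (Perrin-Riou 2003 Prop. 4.8 at `a_p = 0`, derived from theorems printed
with proofs). [cite: Kobayashi2003, Thm. 4.1 (p. 8) and Thm. 1.2 (p. 2)] [cite: BDKim2013, Cor. 3.15 (p. 199)]
[cite: Serre1972, §1.11 Prop. 12] [cite: Wuthrich2014, Lemma 20 (p. 399)] [cite: Miller2011LMS, Def. 1.1]
-/

set_option autoImplicit false
-- the landed namespace `Summit.BirchSwinnertonDyer.BirchSwinnertonDyer.Theorems` (summit = problem) trips the linter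
set_option linter.dupNamespace false

noncomputable section

open scoped Classical

open WeierstrassCurve Literature.NumberTheory.EllipticCurves
  Literature.NumberTheory.EllipticCurves.ModularForms
  Literature.NumberTheory.EllipticCurves.Rank1Residual
  Literature.NumberTheory.EllipticCurves.Rank1Residual.Typed
  Summit.BirchSwinnertonDyer.Rank1Residual.Supersingular

namespace Summit.BirchSwinnertonDyer.BirchSwinnertonDyer.Theorems

variable (W : WeierstrassCurve ℚ) [W.IsElliptic] [W.IsGloballyMinimal] (p : ℕ) [Fact p.Prime]

/-- **Good supersingular odd `p`, `a_p = 0`, `ρ̄_{E,p}` onto, `r_an = 0`, ANY conductor: the upper half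
`ord_p #Ш ≤ ord_p #Ш_an` in the kernel** from Kobayashi Thm. 4.1 / 1.2 + Kim Cor. 3.15 + period
units + modularity + GZK (`missingUpperBoundAt_of_thm41_of_towerSurj`), with the tower surjectivity
from `surj(p)` alone (`GoodSS.towerSurj_of_surj`) and irreducibility from Serre Prop. 12.
[cite: Kobayashi2003, Thm. 4.1 (p. 8)] [cite: BDKim2013, Cor. 3.15 (p. 199)] [cite: Serre1972, §1.11 Prop. 12]
[cite: Wuthrich2014, Lemma 20 (p. 399)] [cite: Miller2011LMS, Def. 1.1] -/
theorem GoodSS.missingUpperBoundAt_rankZero_of_thm41_of_surj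
    (h41 : Kobayashi2003.thm41_signedCharIdeal_divisibility)
    (h12 : Kobayashi2003.thm12_signedSelmerDual_finite_torsion)
    (hKim : BDKim2013.cor315_signedCharValue_rankZero)
    (h5 : realPeriodRat_eq_unit_mul_plusPeriod) (h3 : realPeriodRat_eq_unit_mul_plusPeriod_three)
    (hmod : nonempty_modularParametrizationData) (hmod' : hasEntireLFunction_rat)
    (hGZK : rank_eq_analyticRank_of_analyticRank_le_one)
    (hp : p ≠ 2) (hss : GoodSS W p) (hap : W.frobeniusTrace p = 0) (hs : Surj W p)
    (h0 : W.analyticRank = 0) : MissingUpperBoundAt W p :=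
  missingUpperBoundAt_of_thm41_of_towerSurj W p h41 h12 hKim h5 h3 hmod hGZK hp hss.1 hap
    (hasIrreducibleModPGaloisRep_of_dvd_frobeniusTrace W p hp
      (W.not_dvd_minimalDiscriminantInt_of_hasGoodReductionAtPrime' p hss.1) hss.2)
    (GoodSS.towerSurj_of_surj W p hp hss hs) ((W.analyticRank_eq_zero_iff_holds (hmod' W)).1 h0)

/-- **X7 ∩ {surj(p), a_p = 0}, `r_an = 0`, odd `p`: the upper half in the kernel** (class reading of
`GoodSS.missingUpperBoundAt_rankZero_of_thm41_of_surj`; at `p ≥ 5`, `a_p = 0` is automatic by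
`ClassX7.frobeniusTrace_eq_zero_of_five_le`). Replaces Wuthrich 2014 Prop. 21 / Perrin-Riou 2003
Prop. 4.8 as the rank-`0` upper-half binder on corner A7's surjective branch.
[cite: Kobayashi2003, Thm. 4.1 (p. 8)] [cite: BDKim2013, Cor. 3.15 (p. 199)] [cite: Miller2011LMS, Def. 1.1] -/
theorem X7.missingUpperBoundAt_rankZero_of_thm41_of_surj
    (h41 : Kobayashi2003.thm41_signedCharIdeal_divisibility)
    (h12 : Kobayashi2003.thm12_signedSelmerDual_finite_torsion)
    (hKim : BDKim2013.cor315_signedCharValue_rankZero)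
    (h5 : realPeriodRat_eq_unit_mul_plusPeriod) (h3 : realPeriodRat_eq_unit_mul_plusPeriod_three)
    (hmod : nonempty_modularParametrizationData) (hmod' : hasEntireLFunction_rat)
    (hGZK : rank_eq_analyticRank_of_analyticRank_le_one)
    (hp : p ≠ 2) (hX : ClassX7 W p) (hap : W.frobeniusTrace p = 0) (hs : Surj W p)
    (h0 : W.analyticRank = 0) : MissingUpperBoundAt W p :=
  GoodSS.missingUpperBoundAt_rankZero_of_thm41_of_surj W p h41 h12 hKim h5 h3 hmod hmod' hGZK hp hX.1
    hap hs h0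

/-- **X7 ∩ {surj(p)}, `p ≥ 5`, `r_an = 0`: the upper half in the kernel, `a_p = 0` automatic.**
[cite: Kobayashi2003, Thm. 4.1 (p. 8)] [cite: BDKim2013, Cor. 3.15 (p. 199)] [cite: Miller2011LMS, Def. 1.1] -/
theorem X7.missingUpperBoundAt_rankZero_of_thm41_of_surj_of_five_le
    (h41 : Kobayashi2003.thm41_signedCharIdeal_divisibility)
    (h12 : Kobayashi2003.thm12_signedSelmerDual_finite_torsion)
    (hKim : BDKim2013.cor315_signedCharValue_rankZero)
    (h5 : realPeriodRat_eq_unit_mul_plusPeriod) (h3 : realPeriodRat_eq_unit_mul_plusPeriod_three)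
    (hmod : nonempty_modularParametrizationData) (hmod' : hasEntireLFunction_rat)
    (hGZK : rank_eq_analyticRank_of_analyticRank_le_one)
    (hp5 : 5 ≤ p) (hX : ClassX7 W p) (hs : Surj W p) (h0 : W.analyticRank = 0) :
    MissingUpperBoundAt W p :=
  X7.missingUpperBoundAt_rankZero_of_thm41_of_surj W p h41 h12 hKim h5 h3 hmod hmod' hGZK (by omega) hX
    (ClassX7.frobeniusTrace_eq_zero_of_five_le W p hp5 hX) hs h0

/-- **X7 ∩ {surj(p), a_p = 0}, `r_an = 0`, odd `p`: `BSD(E,p)` from the missing LOWER bound alone,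
upper half in the kernel** — the twin of `Typed.X7.bsdp_of_missingLowerBoundAt_of_surj` with
Wuthrich Prop. 21 replaced by Kobayashi Thm. 4.1 / 1.2 + Kim Cor. 3.15 + period units.
[cite: Kobayashi2003, Thm. 4.1 (p. 8)] [cite: BDKim2013, Cor. 3.15 (p. 199)] [cite: Miller2011LMS, §1 and Def. 1.1] -/
theorem X7.bsdp_of_missingLowerBoundAt_of_thm41_of_surj
    (h41 : Kobayashi2003.thm41_signedCharIdeal_divisibility)
    (h12 : Kobayashi2003.thm12_signedSelmerDual_finite_torsion)
    (hKim : BDKim2013.cor315_signedCharValue_rankZero)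
    (h5 : realPeriodRat_eq_unit_mul_plusPeriod) (h3 : realPeriodRat_eq_unit_mul_plusPeriod_three)
    (hmod : nonempty_modularParametrizationData) (hmod' : hasEntireLFunction_rat)
    (hGZK : rank_eq_analyticRank_of_analyticRank_le_one)
    (hp : p ≠ 2) (hX : ClassX7 W p) (hap : W.frobeniusTrace p = 0) (hs : Surj W p)
    (h0 : W.analyticRank = 0) (hlow : MissingLowerBoundAt W p) : BSDp W p :=
  bsdp_of_missingPPartAt W p hGZK (by omega)
    (missingPPartAt_of_lower_of_upper W p hlow
      (X7.missingUpperBoundAt_rankZero_of_thm41_of_surj W p h41 h12 hKim h5 h3 hmod hmod' hGZK hp hX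
        hap hs h0))

/-- **UNIT-VALUE cells of A7 ∩ {surj(p), a_p = 0}, `r_an = 0`, odd `p`: `BSD(E,p)`** — kernel upper
half + the trivial lower bound `ord_p #Ш_an ≤ 0 ≤ ord_p #Ш`; no main conjecture, no `*_OPEN`, no
Wuthrich Prop. 21. [cite: Kobayashi2003, Thm. 4.1 (p. 8)] [cite: BDKim2013, Cor. 3.15 (p. 199)]
[cite: Miller2011LMS, §1 and Def. 1.1] -/
theorem X7.bsdp_rankZero_of_shaAn_le_of_thm41_of_surj
    (h41 : Kobayashi2003.thm41_signedCharIdeal_divisibility)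
    (h12 : Kobayashi2003.thm12_signedSelmerDual_finite_torsion)
    (hKim : BDKim2013.cor315_signedCharValue_rankZero)
    (h5 : realPeriodRat_eq_unit_mul_plusPeriod) (h3 : realPeriodRat_eq_unit_mul_plusPeriod_three)
    (hmod : nonempty_modularParametrizationData) (hmod' : hasEntireLFunction_rat)
    (hGZK : rank_eq_analyticRank_of_analyticRank_le_one)
    (hp : p ≠ 2) (hX : ClassX7 W p) (hap : W.frobeniusTrace p = 0) (hs : Surj W p)
    (h0 : W.analyticRank = 0) (hsha : ∃ q : ℚ, shaAn W = (q : ℂ) ∧ padicValRat p q ≤ 0) :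
    BSDp W p :=
  bsdp_of_missingUpperBoundAt_of_shaAn_le W p hGZK (by omega)
    (X7.missingUpperBoundAt_rankZero_of_thm41_of_surj W p h41 h12 hKim h5 h3 hmod hmod' hGZK hp hX hap
      hs h0) hsha

end Summit.BirchSwinnertonDyer.BirchSwinnertonDyer.Theorems

end
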